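import Summits.CriticalPhenomena.PercolationContinuityZ3.Theorems.PercNearOneGluingNoHeavyLowerTailSahiC3CubeAnyIndex
import Summits.CriticalPhenomena.PercolationContinuityZ3.Theorems.PercNearOneGluingNoHeavyLowerTailSahiCombSixLetterStrata

/-!
# Kahn's Conjecture 5 / Sahi's `C₃` in the MEASURE vocabulary (`sahiE3 (prodBernoulli q)`) on at most SIX coordinates and on the six-coordinate
# junta / substitution classes — the percolation-facing forms of the six-letter certificate

Support file (cell `prim-sahi`, seat `prim-sahi-typer` gen 36; `--supports stmt-CriticalPhenomena-4575`; proposed `--computational`: the closure contains the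
declared `native_decide` axioms of the six-letter certificate `…ThreePartitionCubeSix` (gen 35) through `…SahiCombSixLetterStrata`; nothing else non-standard,
no `sorry`, no definitions).  Companion of typer gen 28's `…SahiC4CubeFiveAnyIndex` (`sahiC3_of_card_le_five`): the same statements with SIX.

* **`sahiC3_of_card_le_six`** — any `Fintype ι` with `card ι ≤ 6`, any `q : ι → [0,1]`, increasing `A, B, C ⊆ Set ι`: `0 ≤ sahiE3 (prodBernoulli q) A B C`
  (Kahn's Conjecture 5 [Kahn2022, Conj. 5] / Sahi's Conjecture 5 at `n = 3` [Sahi2008] for every product measure on at most six coordinates, e.g. any three increasing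
  events of bond percolation on a graph with at most six edges); `sahiC3_lower_of_card_le_six` — DECREASING events (e.g. three disconnection events of a `≤ 6`-edge graph);
  `sahiPositive_three_bernoulliWeight_of_card_le_six` — `SahiPositive (bernoulliWeight q) 3` (all nonnegative increasing `f, g, h`).
* **`kahn_of_inter_determinedBy_card_le_six`** — EVERY finite `ι`: `0 ≤ sahiE3 (prodBernoulli q) U A B` for increasing `U, A, B` with `A ∩ B` determined by at most
  six coordinates (P3's junta-intersection theorem with the six-letter base, `SahiCombJunta.combPos_sahiE_three_of_inter_determinedBy_card_le_six`);
  **`kahn_of_subst_le_six`** — for monotone Boolean combinations of at most six events with pairwise disjoint supports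
  (`SahiCombSubstitution.combPos_sahiE_three_subst_le_six`; e.g. connection events of a two-terminal network built from `≤ 6` edge-disjoint gadgets, read through
  the gadgets' conduction states).
HONEST LABEL: computational (closure as stated); the six-coordinate CASES only. [this work]
-/

noncomputable section

open scoped Classical

namespace Summit.CriticalPhenomena.PercolationContinuityZ3.Theorems.SahiC3Cube

open Finset Function MeasureTheory
open Literature.Combinatorics.Sahi2008 Literature.Probability.LatticeModels
open Literature.Probability.Percolation (DeterminedBy)
open Literature.Probability.Percolation.DecisionTree (ind ind_nonneg)
open SahiComb

variable {ι : Type} [Fintype ι]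

/-- **Kahn's Conjecture 5 / Sahi's `C₃` for every product measure on at most six coordinates** (any index type; six-letter certificate). [this work]
[computational] -/
theorem sahiC3_of_card_le_six (hι : Fintype.card ι ≤ 6) (q : ι → unitInterval) {A B C : Set (Set ι)}
    (hA : IsUpperSet A) (hB : IsUpperSet B) (hC : IsUpperSet C) : 0 ≤ sahiE3 (prodBernoulli q) A B C := by
  rw [← sahiE_three_ind]
  exact (SahiC3CombCube.combPos_sahiE_three_of_card_le_six hι hA hB hC).nonneg q

/-- **`C₃` for DECREASING events, every product measure on at most six coordinates.** [this work] [computational] -/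
theorem sahiC3_lower_of_card_le_six (hι : Fintype.card ι ≤ 6) (q : ι → unitInterval) {A B C : Set (Set ι)}
    (hA : IsLowerSet A) (hB : IsLowerSet B) (hC : IsLowerSet C) : 0 ≤ sahiE3 (prodBernoulli q) A B C := by
  rw [sahiE3_compl]
  exact sahiC3_of_card_le_six hι _ (isUpperSet_preimage_compl hA) (isUpperSet_preimage_compl hB) (isUpperSet_preimage_compl hC)

/-- `SahiPositive (bernoulliWeight q) 3` on at most six coordinates: all nonnegative increasing `f, g, h : 2^ι → ℝ` have `E₃(μ_q; f, g, h) ≥ 0` (indicators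
suffice, `sahiPositive_iff_indicators`). [this work] [computational] -/
theorem sahiPositive_three_bernoulliWeight_of_card_le_six (hι : Fintype.card ι ≤ 6) (q : ι → unitInterval) :
    SahiPositive (bernoulliWeight q) 3 := by
  rw [sahiPositive_iff_indicators]
  intro U hU
  have hind : (fun i => setInd (U i)) = fun i => ind (U i : Set (Set ι)) := by
    funext i ω
    simp [setInd_apply, ind]
  rw [hind]
  exact SahiC3CombCube.sahiE_three_ind_nonneg_of_card_le_six hι (fun i => (U i : Set (Set ι))) hU q

/-- **Junta-intersection, Kahn form, six coordinates, EVERY finite `ι`**: `0 ≤ E₃(U, A, B)` under `prodBernoulli q` for increasing `U, A, B` with `A ∩ B`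
determined by at most six coordinates. [this work] [computational] -/
theorem kahn_of_inter_determinedBy_card_le_six (q : ι → unitInterval) (W : Finset ι) (hW : W.card ≤ 6) {U A B : Set (Set ι)}
    (hU : IsUpperSet U) (hA : IsUpperSet A) (hB : IsUpperSet B) (hAB : DeterminedBy (A ∩ B) (↑W : Set ι)) :
    0 ≤ sahiE3 (prodBernoulli q) U A B := by
  rw [← sahiE_three_ind]
  exact (SahiCombJunta.combPos_sahiE_three_of_inter_determinedBy_card_le_six W hW hU hA hB hAB).nonneg q

/-- **Block substitution, Kahn form, six blocks, EVERY finite `ι`**: for `r ≤ 6` events `X_j` with pairwise disjoint supports and increasing patterns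
`Φ₀, Φ₁, Φ₂ ⊆ 2^{Fin r}`: `0 ≤ E₃(subst X Φ₀, subst X Φ₁, subst X Φ₂)` under `prodBernoulli q`. [this work] [computational] -/
theorem kahn_of_subst_le_six (q : ι → unitInterval) {r : ℕ} (hr : r ≤ 6) (X : Fin r → Set (Set ι)) (S : Fin r → Finset ι)
    (hS : (Set.univ : Set (Fin r)).PairwiseDisjoint S) (hXd : ∀ j, DeterminedBy (X j) (↑(S j) : Set ι))
    (Φ : Fin 3 → Set (Set (Fin r))) (hΦ : ∀ i, IsUpperSet (Φ i)) :
    0 ≤ sahiE3 (prodBernoulli q) (SahiCombSubstitution.subst X (Φ 0)) (SahiCombSubstitution.subst X (Φ 1))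
      (SahiCombSubstitution.subst X (Φ 2)) := by
  rw [← sahiE_three_ind]
  have h := (SahiCombSubstitution.combPos_sahiE_three_subst_le_six hr X S hS hXd Φ hΦ).nonneg q
  have hfun : (fun i => ind (SahiCombSubstitution.subst X (Φ i))) =
      ![ind (SahiCombSubstitution.subst X (Φ 0)), ind (SahiCombSubstitution.subst X (Φ 1)), ind (SahiCombSubstitution.subst X (Φ 2))] := by
    funext i; fin_cases i <;> rfl
  rwa [hfun] at h

end Summit.CriticalPhenomena.PercolationContinuityZ3.Theorems.SahiC3Cube
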